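import Summits.Ventures.CertifiedManyBodySolver.Observables.CanonicalResponseMonotoneInField
import Summits.Ventures.CertifiedManyBodySolver.Observables.CanonicalCeilingW32TwoW5K4o7SourcedRowG6o7
import Summits.Ventures.CertifiedManyBodySolver.Observables.CanonicalCeilingA0W64W32TwoW5K3o7SourcedRowG5o7
import Summits.Ventures.CertifiedManyBodySolver.Observables.CanonicalCeilingA0W32TwoW5K4o7SourcedRowG5o7
import Summits.Ventures.CertifiedManyBodySolver.Certificates.HubbardSquare_n7o8_lower_row529
import Summits.Ventures.CertifiedManyBodySolver.Certificates.HubbardSquare_n7o8_lower_row504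
import Literature.MathematicalPhysics.QuantumLattice.HubbardTTPrimeEnergyDensityVariationalPrinciple
import HarnessLib

/-!
# FQ1(c) SHAPE: the certified FLOOR on any LINEAR-RESPONSE CONSTANT — chained Griffiths secants = the discrete energy sum rule (hubbard-floor eng-1 g5; zero compute)

The director's FQ1(c) asks on which field interval the certified column is CONSISTENT with linear response `m(h) ≤ C·h`. A single two-sided cell
tests this one field at a time: a floor `x ≤ m(ω_h)` at `h` excludes exactly the constants `C < x/h` (best cell of record, A0′: 0.2918722 @ 0.47140 ⇒
`C ≥ 0.6191545`). This file proves the INTEGRATED test, with no new certificate and no new data: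

§1 (certificate-free; every `t′`, `U ≥ 0`, `n ∈ (0,2)`). For translation-invariant density-`n` minimisers `ω_i` of the canonical-class sourced energy
`E_s(ω) = ω.meanEnergy (hubbardTTPrimeSourcedInteraction 1 t′ U 0 dWaveFormFactor s) 1` at fields `s_0, s_1, …` and `m(ω) = Re ω(P₀^d)`:
* `energyDensityTT'_le_meanEnergy_sourced_add` — ZERO-FIELD ANCHOR: `e(1,t′,U,n) ≤ E_s(ω) + 2s·m(ω)` for every translation-invariant density-`n` state
  (variational principle `energyDensityTT'_le_meanEnergy_of_isTranslationInvariant` + the affine identity `meanEnergy_sourced_eq_sub_two_mul_field` of p676488);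
* `energyDensityTT'_sub_meanEnergy_sourced_chain_le` — CHAINED SECANT (p676488 `secant_le_two_mul_sub_mul_re_expect` applied `k` times + the anchor):
  `e(1,t′,U,n) − E_{s_k}(ω_k) ≤ 2·s_0·m(ω_0) + Σ_{i<k} 2(s_{i+1} − s_i)·m(ω_{i+1})` — the discrete form of the sum rule `e(0) − e(h) = 2∫₀ʰ m`;
* `drop_le_linearConstant_window_succ` / `drop_le_linearConstant_window` — WINDOW FORM: if `lo ≤ e(1,t′,U,n)`, SOME translation-invariant density-`n` state has
  `E_h ≤ u`, and `m(ω) ≤ C·s` for every translation-invariant density-`n` minimiser `ω` of `E_s` at every field of the window `a ≤ s ≤ h`, `0 < s` (`0 ≤ a < h`, `C` real),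
  then `lo − u ≤ 2C·a·h + C·(h−a)²·(j+2)/(j+1)` for every `j : ℕ` (uniform grid `s_i = a + i(h−a)/(j+1)`, minimisers exist by `exists_minimiser_canonicalClass`, the anchor term
  `2a·m(ω_0)` vanishes at `a = 0` and is bounded by the hypothesis at `s = a` otherwise) and hence `lo − u ≤ C·(h² + a²)` — the `j → ∞` step is a genuine limit inside Lean
  (`le_of_forall_pos_le_add` + Archimedes on `|C|(h−a)²/(j+1)`); `linearConstant_ge_drop_div_window`: `(lo − u)/(h² + a²) ≤ C`. Fields below `a` are never used.
* `drop_le_linearConstant_mul_sq` / `linearConstant_ge_drop_div_sq` — the `a = 0` case: hypothesis at every `0 < s ≤ h` ⇒ `lo − u ≤ C·h²`, `(lo − u)/h² ≤ C`. Monotonicity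
  alone (one cell) gives only `lo − u ≤ 2h·m(ω_h) ≤ 2C·h²` — the chained form is exactly TWICE as sharp, and `sup_h (lo − u(h))/h²` is the sharpest linear-response exclusion the
  energy nodes (one zero-field floor + caps) support. PRECISION (hubbard-floor crit-1, adopted): the `a = 0` hypothesis bounds the minimisers' response by `C·s` down to `s → 0⁺`,
  i.e. it presupposes no residual response at `0⁺`; nothing in the tree certifies it for any `C` — the theorems are CONDITIONAL EXCLUSIONS («if linear with constant C, then
  C ≥ c₀»), exactly the logical status of every pointwise cell reading; the window form is the variant that does not touch fields below `a`.

§2 (instances ON NODES, one per class; `c₀ = (ℓ − A − B·g)/(2g²)` is an exact RATIONAL — `h² = 2g²`, no `√2` rounding; 7 dp DOWN):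
* `linearResponseConstant_ge_n7o8_tp0_r529_g1o3` — A0′ = (8, ⅞, t′ 0), `h = √2/3` (h_tree ≈ 0.47140, `g = 1/3`, within 0.001 of the maximiser `g* = 2(ℓ−A)/B ≈ 0.3325`
  of `c₀` over the typed t′0 continua): **every `C` with `m ≤ C·s` at all fields `0 < s ≤ √2/3` satisfies `1.2383089 ≤ C`** (exact `c₀ = 1.2383089316…`;
  drop `ℓ₅₂₉ − (A + B/3) = 0.2751797625…` per site), CONDITIONAL by name on #529 `cert_r529_…_focert_it2000` and the κ 4/7 twins
  `cert_sgf_openbox32x4_U8_mu2_k4o7_j270192_twoField` ⊕ `cert_sgf_openbox32x4_U8_mu9o4_k4o7_j271580_twoField` (W5-exact-replayed R2 j321857 / R3 j321859) through the cap witness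
  `exists_canonicalClass_sourced_le_W32twoW5k4o7_b1` (cq; the (A, B) of cq p539493 `canonicalFloor_n7o8_tp0_W32twoW5k4o7r529_b1_continuum`); pointwise exclusion of the same
  nodes at the same field: 0.6191545.
* `linearResponseConstantA0_ge_n7o8_tpm1o4_r504_g5o14` — A0 = (8, ⅞, t′ −¼), `h = √2·5/14` (≈ 0.50508, an A0 cell of record): **`1.0136859 ≤ C`** (exact 1.0136859187…;
  drop 0.2585933466…), CONDITIONAL on #504 `cert_r504_…_uprime` and the diag-hop readings `…_k3o7_j276038_twoFieldDiagHop` (R5′ j324543) ⊕ `…_mu2_k3o7_j269676_twoFieldDiagHop` (R6 j323154)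
  through `exists_canonicalClassA0_sourced_le_A0W64W32twoW5k3o7_b1` (cq; the (A, B) of `canonicalFloorA0_n7o8_A0W64W32twoW5k3o7_b1_continuum`); pointwise 0.5068430.

* `linearResponseConstantA0_ge_n7o8_tpm1o4_r504_k4o7_g3o8` (§3, hubbard-floor eng-1 g5 APPEND «T4b», after cq lens-anomaly-1's by-value remark that the cq A0 COLUMN OF RECORD at these
  fields is the κ 4/7 SAME-FIELD TWO-W5 DIAG-HOP edition p526218, cq RULING 416) — A0, `h = √2·3/8` (≈ 0.53033; `g* = 2(ℓ−A)/B ≈ 0.3783` on this cap line): **`1.0882047 ≤ C`**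
  (exact `(ℓ₅₀₄ − A − 3B/8)·32/9 = 1.0882047987…`; drop 0.3060575… per site over `h² = 9/32`), CONDITIONAL on #504 and the κ 4/7 twins' diag-hop readings
  `cert_sgf_openbox32x4_U8_mu2_k4o7_j270192_twoFieldDiagHop` (R2 j321857) ⊕ `cert_sgf_openbox32x4_U8_mu9o4_k4o7_j271580_twoFieldDiagHop` (R3 j321859) through cq's
  `exists_canonicalClassA0_sourced_le_A0twoW5k4o7_b1` (the (A, B) of p526218 `canonicalFloorA0_n7o8_A0twoW5k4o7_b1_continuum`); sharper than the κ 3/7 instance above (1.0136859);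
  pointwise exclusion of the same nodes at the same field 0.5441023.

READING (pre-stated on the cell bus before landing): «the certified column EXCLUDES linear response m ≤ C·h on (0, 0.4714] for every C < 1.2383089 (A0′; on (0, 0.5051]
for C < 1.0136859, A0); it excludes NO constant from above (ceilings cannot), so consistency with linear response stays open-ended — FQ1(c) INFORMATIVE = NO in the
brief's sense is unchanged; the admissible-C floor doubles (0.619 → 1.238) from the same nodes». HONEST FRAMING: a statement about translation-invariant density-⅞
minimisers of the d-wave-SOURCED energy under an EXPLICIT linear-response hypothesis; nothing about `h → 0` beyond that hypothesis; never an onset, an order parameter,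
a gap or `T_c`; superconductivity in the Hubbard model is NOT proved or disproved by any of this. No definition; no named fact; no new node; no `sorry`.
References: R. B. Griffiths, Phys. Rev. 152 (1966) 240 §II (field derivatives of a concave free energy; secant bounds); D. Ruelle, *Statistical Mechanics* (1969) §3.4.
-/

noncomputable section

namespace Summit.Ventures.CertifiedManyBodySolver.Observables

open Matrix Finset Literature.Probability.LatticeModels
open Literature.MathematicalPhysics.QuantumLattice Literature.MathematicalPhysics.QuantumLattice.ThermodynamicLimit
open Literature.MathematicalPhysics.QuantumLattice.TwoCluster InfVolFermionState
open Summit.Ventures.CertifiedManyBodySolver Summit.Ventures.CertifiedManyBodySolver.Certificates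
open scoped ComplexOrder

/-! ## §1  Certificate-free: zero-field anchor, chained secant, the linear-constant bound -/

section LinearConstant

variable {t' U n : ℝ}

/-- **ZERO-FIELD ANCHOR.** For a translation-invariant state `ω` of density `n ∈ (0,2)` and `U ≥ 0`: `e(1,t′,U,n) ≤ E_s(ω) + 2s·Re ω(P₀^d)` at every field `s`
(variational principle for the zero-field `t–t′` energy density + the affine identity `E_s(ω) = E^{tt′U}(ω) − 2s·Re ω(P₀^d)`). [cite: Ruelle1969, §3.4] -/
theorem energyDensityTT'_le_meanEnergy_sourced_add (hU : 0 ≤ U) (hn0 : 0 < n) (hn2 : n < 2) {ω : InfVolFermionState 2}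
    (hω : ω.IsTranslationInvariant) (hρ : ω.density = n) (s : ℝ) :
    energyDensityTT' 1 t' U n ≤ ω.meanEnergy (hubbardTTPrimeSourcedInteraction 1 t' U 0 dWaveFormFactor s) 1 +
      2 * s * (ω.expect (pairRegion (insert 0 unitSteps) 0) (localPairAt (insert 0 unitSteps) dWaveFormFactor 0)).re := by
  have h := energyDensityTT'_le_meanEnergy_of_isTranslationInvariant 1 t' hU hn0 hn2 hω hρ
  rw [meanEnergy_sourced_eq_sub_two_mul_field ω t' U s]
  linarith

/-- **CHAINED SECANT (discrete energy sum rule).** For fields `s : ℕ → ℝ` and translation-invariant density-`n` states `ω : ℕ → _` with `ω i` a minimiser of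
`E_{s i}` (`U ≥ 0`, `n ∈ (0,2)`): for every `k`, `e(1,t′,U,n) − E_{s k}(ω k) ≤ 2·(s 0)·m(ω 0) + Σ_{i<k} 2(s (i+1) − s i)·m(ω (i+1))` — the anchor plus `k` Griffiths secants
`E_{s i}(ω i) − E_{s (i+1)}(ω (i+1)) ≤ 2(s (i+1) − s i)·m(ω (i+1))` (p676488). No order on the fields is needed. [cite: Griffiths1966, §II] -/
theorem energyDensityTT'_sub_meanEnergy_sourced_chain_le (hU : 0 ≤ U) (hn0 : 0 < n) (hn2 : n < 2) (s : ℕ → ℝ) (ω : ℕ → InfVolFermionState 2)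
    (hω : ∀ i, (ω i).IsTranslationInvariant) (hρ : ∀ i, (ω i).density = n)
    (hmin : ∀ i, ∀ ω' : InfVolFermionState 2, ω'.IsTranslationInvariant → ω'.density = n →
      (ω i).meanEnergy (hubbardTTPrimeSourcedInteraction 1 t' U 0 dWaveFormFactor (s i)) 1 ≤
        ω'.meanEnergy (hubbardTTPrimeSourcedInteraction 1 t' U 0 dWaveFormFactor (s i)) 1) (k : ℕ) :
    energyDensityTT' 1 t' U n - (ω k).meanEnergy (hubbardTTPrimeSourcedInteraction 1 t' U 0 dWaveFormFactor (s k)) 1 ≤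
      2 * s 0 * ((ω 0).expect (pairRegion (insert 0 unitSteps) 0) (localPairAt (insert 0 unitSteps) dWaveFormFactor 0)).re +
        ∑ i ∈ Finset.range k, 2 * (s (i + 1) - s i) *
          ((ω (i + 1)).expect (pairRegion (insert 0 unitSteps) 0) (localPairAt (insert 0 unitSteps) dWaveFormFactor 0)).re := by
  induction k with
  | zero =>
    rw [Finset.sum_range_zero, add_zero]
    have h0 := energyDensityTT'_le_meanEnergy_sourced_add (t' := t') hU hn0 hn2 (hω 0) (hρ 0) (s 0)
    linarith
  | succ k ih =>
    rw [Finset.sum_range_succ]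
    have hstep := secant_le_two_mul_sub_mul_re_expect (t' := t') (U := U) (h₁ := s k) (h₂ := s (k + 1)) (hω (k + 1)) (hρ (k + 1)) (hmin k)
    linarith

/-- `Σ_{i<k} (a + (i+1)·d) = k·a + d·k(k+1)/2` over `ℝ`. [folklore] -/
private theorem sum_range_affine (a d : ℝ) (k : ℕ) :
    ∑ i ∈ Finset.range k, (a + ((i : ℝ) + 1) * d) = (k : ℝ) * a + d * ((k : ℝ) * ((k : ℝ) + 1) / 2) := by
  induction k with
  | zero => simp
  | succ k ih => rw [Finset.sum_range_succ, ih]; push_cast; ring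

/-- **LINEAR-RESPONSE CONSTANT ON A FIELD WINDOW vs the certified energy drop, finite grid.** `U ≥ 0`, `n ∈ (0,2)`, `0 ≤ a < h`, `C` real. If `lo ≤ e(1,t′,U,n)` (a zero-field
energy floor), SOME translation-invariant density-`n` state has `E_h ≤ u` (a cap at field `h`), and `Re ω(P₀^d) ≤ C·s` for every translation-invariant density-`n` minimiser `ω` of `E_s`
at every field `s` of the WINDOW `a ≤ s ≤ h`, `0 < s`, then for every `j : ℕ`: `lo − u ≤ 2C·a·h + C·(h − a)²·(j+2)/(j+1)` — chained secant on the uniform grid `s_i = a + i(h−a)/(j+1)`,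
`i = 0 … j+1` (minimisers by `exists_minimiser_canonicalClass`; the anchor term `2a·m(ω_0)` vanishes when `a = 0` and is bounded by the hypothesis at `s = a` otherwise; fields below `a`
are never used). [cite: Griffiths1966, §II] -/
theorem drop_le_linearConstant_window_succ (hU : 0 ≤ U) (hn0 : 0 < n) (hn2 : n < 2) {a h lo u C : ℝ} (ha : 0 ≤ a) (hah : a < h)
    (hlo : lo ≤ energyDensityTT' 1 t' U n)
    (hcap : ∃ σ : InfVolFermionState 2, σ.IsTranslationInvariant ∧ σ.density = n ∧
      σ.meanEnergy (hubbardTTPrimeSourcedInteraction 1 t' U 0 dWaveFormFactor h) 1 ≤ u)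
    (hlin : ∀ s : ℝ, 0 < s → a ≤ s → s ≤ h → ∀ ω : InfVolFermionState 2, ω.IsTranslationInvariant → ω.density = n →
      (∀ ω' : InfVolFermionState 2, ω'.IsTranslationInvariant → ω'.density = n →
        ω.meanEnergy (hubbardTTPrimeSourcedInteraction 1 t' U 0 dWaveFormFactor s) 1 ≤
          ω'.meanEnergy (hubbardTTPrimeSourcedInteraction 1 t' U 0 dWaveFormFactor s) 1) →
      (ω.expect (pairRegion (insert 0 unitSteps) 0) (localPairAt (insert 0 unitSteps) dWaveFormFactor 0)).re ≤ C * s)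
    (j : ℕ) : lo - u ≤ 2 * C * a * h + C * (h - a) ^ 2 * (((j : ℝ) + 2) / ((j : ℝ) + 1)) := by
  have hj1 : (0 : ℝ) < (j : ℝ) + 1 := by positivity
  -- the uniform grid `s i = a + i·d`, `d = (h − a)/(j+1)`, and its minimisers
  obtain ⟨d, hd⟩ : ∃ d : ℝ, d = (h - a) / ((j : ℝ) + 1) := ⟨_, rfl⟩
  have hdpos : 0 < d := by rw [hd]; exact div_pos (sub_pos.2 hah) hj1
  obtain ⟨s, hs⟩ : ∃ s : ℕ → ℝ, ∀ i, s i = a + (i : ℝ) * d := ⟨fun i => a + (i : ℝ) * d, fun i => rfl⟩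
  have hex : ∀ i : ℕ, ∃ ω : InfVolFermionState 2, ω.IsTranslationInvariant ∧ ω.density = n ∧
      ∀ ω' : InfVolFermionState 2, ω'.IsTranslationInvariant → ω'.density = n →
        ω.meanEnergy (hubbardTTPrimeSourcedInteraction 1 t' U 0 dWaveFormFactor (s i)) 1 ≤
          ω'.meanEnergy (hubbardTTPrimeSourcedInteraction 1 t' U 0 dWaveFormFactor (s i)) 1 :=
    fun i => exists_minimiser_canonicalClass (n := n) (hubbardTTPrimeSourcedInteraction 1 t' U 0 dWaveFormFactor (s i)) hn0.le hn2
  choose ω hω hρ hmin using hex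
  -- the chain up to index j+1, where the field is `s (j+1) = h`
  have hchain := energyDensityTT'_sub_meanEnergy_sourced_chain_le (t' := t') hU hn0 hn2 s ω hω hρ hmin (j + 1)
  have hsj : s (j + 1) = h := by rw [hs, hd]; push_cast; field_simp; ring
  obtain ⟨σ, hσ, hσn, hσu⟩ := hcap
  have hmj := hmin (j + 1) σ hσ hσn
  rw [hsj] at hmj hchain
  have htop : (ω (j + 1)).meanEnergy (hubbardTTPrimeSourcedInteraction 1 t' U 0 dWaveFormFactor h) 1 ≤ u := hmj.trans hσu
  -- the linear hypothesis at the grid fields `s i`, `1 ≤ i ≤ j+1` (and at `s 0 = a` when `a > 0`)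
  have hsle : ∀ i, i ≤ j + 1 → s i ≤ h := by
    intro i hi
    have hij : (i : ℝ) ≤ (j : ℝ) + 1 := by exact_mod_cast hi
    rw [← hsj, hs, hs]
    push_cast
    nlinarith
  have hsge : ∀ i, a ≤ s i := fun i => by rw [hs]; nlinarith [hdpos.le, (Nat.cast_nonneg i : (0 : ℝ) ≤ i)]
  have hspos : ∀ i, 1 ≤ i → 0 < s i := by
    intro i hi
    have hi' : (1 : ℝ) ≤ (i : ℝ) := by exact_mod_cast hi
    rw [hs]; nlinarith
  have hm : ∀ i, 1 ≤ i → i ≤ j + 1 →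
      ((ω i).expect (pairRegion (insert 0 unitSteps) 0) (localPairAt (insert 0 unitSteps) dWaveFormFactor 0)).re ≤ C * s i :=
    fun i hi1 hi => hlin (s i) (hspos i hi1) (hsge i) (hsle i hi) (ω i) (hω i) (hρ i) (hmin i)
  -- the anchor term `2·a·m(ω 0) ≤ 2·C·a·a`
  have hs0 : s 0 = a := by rw [hs]; simp
  have h0 : 2 * s 0 * ((ω 0).expect (pairRegion (insert 0 unitSteps) 0) (localPairAt (insert 0 unitSteps) dWaveFormFactor 0)).re ≤
      2 * C * a * a := by
    rw [hs0]
    rcases eq_or_lt_of_le ha with h0a | h0a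
    · rw [← h0a]; simp
    · have hma := hlin a h0a le_rfl hah.le (ω 0) (hω 0) (hρ 0) (by rw [← hs0]; exact hmin 0)
      nlinarith
  -- the secant terms
  have hterms : ∀ i ∈ Finset.range (j + 1), 2 * (s (i + 1) - s i) *
      ((ω (i + 1)).expect (pairRegion (insert 0 unitSteps) 0) (localPairAt (insert 0 unitSteps) dWaveFormFactor 0)).re ≤
        2 * d * C * (a + ((i : ℝ) + 1) * d) := by
    intro i hi
    have hij : i + 1 ≤ j + 1 := Nat.succ_le_of_lt (Finset.mem_range.mp hi)
    have hdi : s (i + 1) - s i = d := by rw [hs, hs]; push_cast; ring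
    have hsi : s (i + 1) = a + ((i : ℝ) + 1) * d := by rw [hs]; push_cast; ring
    have h1 := mul_le_mul_of_nonneg_left (hm (i + 1) (Nat.succ_le_succ (Nat.zero_le i)) hij) (by positivity : (0 : ℝ) ≤ 2 * d)
    rw [hdi]
    rw [hsi] at h1
    nlinarith
  have hsum := Finset.sum_le_sum hterms
  rw [← Finset.mul_sum, sum_range_affine] at hsum
  -- assemble: lo − u ≤ 2·C·a² + 2·d·C·((j+1)·a + d·(j+1)(j+2)/2) = 2C·a·h + C·(h−a)²·(j+2)/(j+1)
  have hid : 2 * C * a * a + 2 * d * C * ((((j + 1 : ℕ) : ℝ)) * a + d * ((((j + 1 : ℕ) : ℝ)) * ((((j + 1 : ℕ) : ℝ)) + 1) / 2)) =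
      2 * C * a * h + C * (h - a) ^ 2 * (((j : ℝ) + 2) / ((j : ℝ) + 1)) := by
    rw [hd]; push_cast; field_simp; ring
  linarith [hid]

/-- **LINEAR-RESPONSE CONSTANT ON A FIELD WINDOW vs the certified energy drop.** Under the hypotheses of `drop_le_linearConstant_window_succ`:
`lo − u ≤ C·(h² + a²)` (grid refinement `(j+2)/(j+1) → 1`, a genuine limit argument: `le_of_forall_pos_le_add` + Archimedes; `2C·a·h + C·(h−a)² = C·(h² + a²)`).
The window form uses the hypothesis ONLY at fields `a ≤ s ≤ h`: it does not constrain the response below `a`. [cite: Griffiths1966, §II] -/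
theorem drop_le_linearConstant_window (hU : 0 ≤ U) (hn0 : 0 < n) (hn2 : n < 2) {a h lo u C : ℝ} (ha : 0 ≤ a) (hah : a < h)
    (hlo : lo ≤ energyDensityTT' 1 t' U n)
    (hcap : ∃ σ : InfVolFermionState 2, σ.IsTranslationInvariant ∧ σ.density = n ∧
      σ.meanEnergy (hubbardTTPrimeSourcedInteraction 1 t' U 0 dWaveFormFactor h) 1 ≤ u)
    (hlin : ∀ s : ℝ, 0 < s → a ≤ s → s ≤ h → ∀ ω : InfVolFermionState 2, ω.IsTranslationInvariant → ω.density = n →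
      (∀ ω' : InfVolFermionState 2, ω'.IsTranslationInvariant → ω'.density = n →
        ω.meanEnergy (hubbardTTPrimeSourcedInteraction 1 t' U 0 dWaveFormFactor s) 1 ≤
          ω'.meanEnergy (hubbardTTPrimeSourcedInteraction 1 t' U 0 dWaveFormFactor s) 1) →
      (ω.expect (pairRegion (insert 0 unitSteps) 0) (localPairAt (insert 0 unitSteps) dWaveFormFactor 0)).re ≤ C * s) :
    lo - u ≤ C * (h ^ 2 + a ^ 2) := by
  have hfin := drop_le_linearConstant_window_succ (t' := t') hU hn0 hn2 ha hah hlo hcap hlin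
  have hrew : C * (h ^ 2 + a ^ 2) = 2 * C * a * h + C * (h - a) ^ 2 := by ring
  rw [hrew]
  refine le_of_forall_pos_le_add fun ε hε => ?_
  -- choose j with |C|·(h−a)²/(j+1) < ε
  obtain ⟨j, hj⟩ := exists_nat_gt (|C| * (h - a) ^ 2 / ε)
  have hj1 : (0 : ℝ) < (j : ℝ) + 1 := by positivity
  have hfj := hfin j
  have hsplit : C * (h - a) ^ 2 * (((j : ℝ) + 2) / ((j : ℝ) + 1)) = C * (h - a) ^ 2 + C * (h - a) ^ 2 / ((j : ℝ) + 1) := by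
    field_simp; ring
  rw [hsplit] at hfj
  have hsmall : C * (h - a) ^ 2 / ((j : ℝ) + 1) ≤ ε := by
    rw [div_le_iff₀ hj1]
    have h1 : C * (h - a) ^ 2 ≤ |C| * (h - a) ^ 2 := mul_le_mul_of_nonneg_right (le_abs_self C) (by positivity)
    have h2 : |C| * (h - a) ^ 2 < (j : ℝ) * ε := (div_lt_iff₀ hε).mp hj
    have h3 : (0 : ℝ) ≤ ε := hε.le
    nlinarith
  linarith

/-- **LINEAR-RESPONSE CONSTANT vs the certified energy drop (whole range `0 < s ≤ h`).** `U ≥ 0`, `n ∈ (0,2)`, `h > 0`, `C` real. If `lo ≤ e(1,t′,U,n)`, SOME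
translation-invariant density-`n` state has `E_h ≤ u`, and `Re ω(P₀^d) ≤ C·s` for every translation-invariant density-`n` minimiser `ω` of `E_s` at every field `0 < s ≤ h`,
then `lo − u ≤ C·h²` (the window theorem at `a = 0`). Twice as sharp as the one-cell (monotonicity-only) test `lo − u ≤ 2h·m(ω_h) ≤ 2C·h²`. NOTE (hubbard-floor crit-1's precision,
adopted): this hypothesis bounds the response of minimisers by `C·s` all the way down to `s → 0⁺` — it is a CONDITIONAL exclusion, certified by nothing in the tree; the window form
above is the version that does not touch small fields. [cite: Griffiths1966, §II] -/
theorem drop_le_linearConstant_mul_sq (hU : 0 ≤ U) (hn0 : 0 < n) (hn2 : n < 2) {h lo u C : ℝ} (hh : 0 < h)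
    (hlo : lo ≤ energyDensityTT' 1 t' U n)
    (hcap : ∃ σ : InfVolFermionState 2, σ.IsTranslationInvariant ∧ σ.density = n ∧
      σ.meanEnergy (hubbardTTPrimeSourcedInteraction 1 t' U 0 dWaveFormFactor h) 1 ≤ u)
    (hlin : ∀ s : ℝ, 0 < s → s ≤ h → ∀ ω : InfVolFermionState 2, ω.IsTranslationInvariant → ω.density = n →
      (∀ ω' : InfVolFermionState 2, ω'.IsTranslationInvariant → ω'.density = n →
        ω.meanEnergy (hubbardTTPrimeSourcedInteraction 1 t' U 0 dWaveFormFactor s) 1 ≤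
          ω'.meanEnergy (hubbardTTPrimeSourcedInteraction 1 t' U 0 dWaveFormFactor s) 1) →
      (ω.expect (pairRegion (insert 0 unitSteps) 0) (localPairAt (insert 0 unitSteps) dWaveFormFactor 0)).re ≤ C * s) :
    lo - u ≤ C * h ^ 2 := by
  have hw := drop_le_linearConstant_window (t' := t') hU hn0 hn2 le_rfl hh hlo hcap
    (fun s hs0 _ hsh ω hω hρ hmin => hlin s hs0 hsh ω hω hρ hmin)
  simpa using hw

/-- **THE LINEAR-RESPONSE CONSTANT FLOOR**: under the hypotheses of `drop_le_linearConstant_mul_sq`, `(lo − u)/h² ≤ C`. [cite: Griffiths1966, §II] -/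
theorem linearConstant_ge_drop_div_sq (hU : 0 ≤ U) (hn0 : 0 < n) (hn2 : n < 2) {h lo u C : ℝ} (hh : 0 < h)
    (hlo : lo ≤ energyDensityTT' 1 t' U n)
    (hcap : ∃ σ : InfVolFermionState 2, σ.IsTranslationInvariant ∧ σ.density = n ∧
      σ.meanEnergy (hubbardTTPrimeSourcedInteraction 1 t' U 0 dWaveFormFactor h) 1 ≤ u)
    (hlin : ∀ s : ℝ, 0 < s → s ≤ h → ∀ ω : InfVolFermionState 2, ω.IsTranslationInvariant → ω.density = n →
      (∀ ω' : InfVolFermionState 2, ω'.IsTranslationInvariant → ω'.density = n →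
        ω.meanEnergy (hubbardTTPrimeSourcedInteraction 1 t' U 0 dWaveFormFactor s) 1 ≤
          ω'.meanEnergy (hubbardTTPrimeSourcedInteraction 1 t' U 0 dWaveFormFactor s) 1) →
      (ω.expect (pairRegion (insert 0 unitSteps) 0) (localPairAt (insert 0 unitSteps) dWaveFormFactor 0)).re ≤ C * s) :
    (lo - u) / h ^ 2 ≤ C := by
  rw [div_le_iff₀ (by positivity)]
  exact drop_le_linearConstant_mul_sq (t' := t') hU hn0 hn2 hh hlo hcap hlin

/-- **THE WINDOW FORM OF THE FLOOR**: under the hypotheses of `drop_le_linearConstant_window` (`0 ≤ a < h`, hypothesis only on `a ≤ s ≤ h`), `(lo − u)/(h² + a²) ≤ C`. [cite: Griffiths1966, §II] -/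
theorem linearConstant_ge_drop_div_window (hU : 0 ≤ U) (hn0 : 0 < n) (hn2 : n < 2) {a h lo u C : ℝ} (ha : 0 ≤ a) (hah : a < h)
    (hlo : lo ≤ energyDensityTT' 1 t' U n)
    (hcap : ∃ σ : InfVolFermionState 2, σ.IsTranslationInvariant ∧ σ.density = n ∧
      σ.meanEnergy (hubbardTTPrimeSourcedInteraction 1 t' U 0 dWaveFormFactor h) 1 ≤ u)
    (hlin : ∀ s : ℝ, 0 < s → a ≤ s → s ≤ h → ∀ ω : InfVolFermionState 2, ω.IsTranslationInvariant → ω.density = n →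
      (∀ ω' : InfVolFermionState 2, ω'.IsTranslationInvariant → ω'.density = n →
        ω.meanEnergy (hubbardTTPrimeSourcedInteraction 1 t' U 0 dWaveFormFactor s) 1 ≤
          ω'.meanEnergy (hubbardTTPrimeSourcedInteraction 1 t' U 0 dWaveFormFactor s) 1) →
      (ω.expect (pairRegion (insert 0 unitSteps) 0) (localPairAt (insert 0 unitSteps) dWaveFormFactor 0)).re ≤ C * s) :
    (lo - u) / (h ^ 2 + a ^ 2) ≤ C := by
  have hpos : 0 < h ^ 2 + a ^ 2 := by have := sq_nonneg a; have : 0 < h := ha.trans_lt hah; positivity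
  rw [div_le_iff₀ hpos]
  exact drop_le_linearConstant_window (t' := t') hU hn0 hn2 ha hah hlo hcap hlin

end LinearConstant

/-! ## §2  Instances on nodes: one per class -/

section Instances

/-- **A0′ LINEAR-RESPONSE CONSTANT FLOOR (t′ = 0, U = 8, n = ⅞; #529 × the κ 4/7 twins' b1 cap at g = 1/3).** For every real `C`: if `Re ω(P₀^d) ≤ C·s` for every
translation-invariant density-⅞ minimiser `ω` of `E_s` at every field `0 < s ≤ √2/3` (h_tree ≤ 0.47140), then **`1.2383089 ≤ C`** (exact `c₀ = (ℓ₅₂₉ − A − B/3)·9/2 =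
1.2383089316…`, 7 dp DOWN; energy drop `ℓ₅₂₉ − (A + B/3) = 0.2751797…` per site over `h² = 2/9`). CONDITIONAL by name on #529 and the two κ 4/7 W5 nodes (cap witness
`exists_canonicalClass_sourced_le_W32twoW5k4o7_b1`, the (A, B) of `canonicalFloor_n7o8_tp0_W32twoW5k4o7r529_b1_continuum`). The one-cell (pointwise) exclusion of the same nodes at the
same field is `C ≥ 0.6191545`. An EXCLUSION of small constants only — no constant is excluded from above; hypothesis explicit; never onset / order / gap / `T_c`. [cite: Griffiths1966, §II] -/
theorem linearResponseConstant_ge_n7o8_tp0_r529_g1o3 (C : ℝ)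
    (hlin : ∀ s : ℝ, 0 < s → s ≤ Real.sqrt 2 * (1 / 3 : ℝ) → ∀ ω : InfVolFermionState 2, ω.IsTranslationInvariant → ω.density = 7 / 8 →
      (∀ ω' : InfVolFermionState 2, ω'.IsTranslationInvariant → ω'.density = 7 / 8 →
        ω.meanEnergy (hubbardTTPrimeSourcedInteraction 1 0 8 0 dWaveFormFactor s) 1 ≤
          ω'.meanEnergy (hubbardTTPrimeSourcedInteraction 1 0 8 0 dWaveFormFactor s) 1) →
      (ω.expect (pairRegion (insert 0 unitSteps) 0) (localPairAt (insert 0 unitSteps) dWaveFormFactor 0)).re ≤ C * s)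
    (hfl : cert_r529_HYB_GU8n7o8eom8_w3_b4_R2_ob5p2_kry1_kry2c3rel_menu_core_focert_it2000)
    (hW₁ : cert_sgf_openbox32x4_U8_mu2_k4o7_j270192_twoField) (hW₂ : cert_sgf_openbox32x4_U8_mu9o4_k4o7_j271580_twoField) :
    (1.2383089 : ℝ) ≤ C := by
  have hh : 0 < Real.sqrt 2 * (1 / 3 : ℝ) := by positivity
  have hcap := exists_canonicalClass_sourced_le_W32twoW5k4o7_b1 (1 / 3 : ℝ) (by norm_num) ⟨by norm_num, by norm_num⟩ hW₁ hW₂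
  have hdrop := drop_le_linearConstant_mul_sq (t' := (0 : ℝ)) (U := (8 : ℝ)) (n := (7 / 8 : ℝ)) (by norm_num) (by norm_num) (by norm_num) hh hfl hcap hlin
  have hsq : (Real.sqrt 2 * (1 / 3 : ℝ)) ^ 2 = 2 / 9 := by
    rw [mul_pow, Real.sq_sqrt (by norm_num : (0 : ℝ) ≤ 2)]; norm_num
  rw [hsq] at hdrop
  have hnum : (1.2383089 : ℝ) * (2 / 9) ≤
      (((-1002888528743611882756433 / 1208925819614629174706176 : ℚ)) : ℝ) -
        ((((-32096550505043117373833979014248934748431 / 57751603071010263693174918610944000000000 : ℚ)) : ℝ) +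
          (((-2434906847701746851347812280115039027 / 1478441038617862750545277916440166400 : ℚ)) : ℝ) * (1 / 3 : ℝ)) := by
    push_cast; norm_num
  push_cast at hdrop hnum
  nlinarith

/-- **A0 LINEAR-RESPONSE CONSTANT FLOOR (t′ = −1/4, U = 8, n = ⅞; #504 × the diag-hop κ 3/7 W64 ⊕ W32 pair's b1 cap at g = 5/14).** For every real `C`: if `Re ω(P₀^d) ≤ C·s`
for every translation-invariant density-⅞ minimiser `ω` of `E^{−1/4}_s` at every field `0 < s ≤ √2·5/14` (h_tree ≤ 0.50508, an A0 cell of record), then **`1.0136859 ≤ C`**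
(exact `c₀ = (ℓ₅₀₄ − A − 5B/14)·196/50 = 1.0136859187…`, 7 dp DOWN; drop 0.2585933… per site over `h² = 25/98`). CONDITIONAL by name on #504 and the two diag-hop W5 readings
(cap witness `exists_canonicalClassA0_sourced_le_A0W64W32twoW5k3o7_b1`, the (A, B) of `canonicalFloorA0_n7o8_A0W64W32twoW5k3o7_b1_continuum`); pointwise exclusion at the same field
0.5068430. Exclusion of small constants only; hypothesis explicit; never onset / order / gap / `T_c`. [cite: Griffiths1966, §II] -/
theorem linearResponseConstantA0_ge_n7o8_tpm1o4_r504_g5o14 (C : ℝ)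
    (hlin : ∀ s : ℝ, 0 < s → s ≤ Real.sqrt 2 * (5 / 14 : ℝ) → ∀ ω : InfVolFermionState 2, ω.IsTranslationInvariant → ω.density = 7 / 8 →
      (∀ ω' : InfVolFermionState 2, ω'.IsTranslationInvariant → ω'.density = 7 / 8 →
        ω.meanEnergy (hubbardTTPrimeSourcedInteraction 1 (-1 / 4) 8 0 dWaveFormFactor s) 1 ≤
          ω'.meanEnergy (hubbardTTPrimeSourcedInteraction 1 (-1 / 4) 8 0 dWaveFormFactor s) 1) →
      (ω.expect (pairRegion (insert 0 unitSteps) 0) (localPairAt (insert 0 unitSteps) dWaveFormFactor 0)).re ≤ C * s)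
    (h504 : cert_r504_bs_GU8n7o8tpm1o4_w3_b4_R2_ob5p2_kry1_kry2c3rel_hanK7B4D4_KN4_PR20d4_hanK8c2s_uprime)
    (hW₁ : cert_sgf_openbox64x4_U8_mu980464777135o549755813888_k3o7_j276038_twoFieldDiagHop) (hW₂ : cert_sgf_openbox32x4_U8_mu2_k3o7_j269676_twoFieldDiagHop) :
    (1.0136859 : ℝ) ≤ C := by
  have hh : 0 < Real.sqrt 2 * (5 / 14 : ℝ) := by positivity
  have hcap := exists_canonicalClassA0_sourced_le_A0W64W32twoW5k3o7_b1 (5 / 14 : ℝ) (by norm_num) ⟨by norm_num, by norm_num⟩ hW₁ hW₂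
  have hdrop := drop_le_linearConstant_mul_sq (t' := (-1 / 4 : ℝ)) (U := (8 : ℝ)) (n := (7 / 8 : ℝ)) (by norm_num) (by norm_num) (by norm_num) hh h504 hcap hlin
  have hsq : (Real.sqrt 2 * (5 / 14 : ℝ)) ^ 2 = 25 / 98 := by
    rw [mul_pow, Real.sq_sqrt (by norm_num : (0 : ℝ) ≤ 2)]; norm_num
  rw [hsq] at hdrop
  have hnum : (1.0136859 : ℝ) * (25 / 98) ≤
      (((-1008420703687177600106633 / 1208925819614629174706176 : ℚ)) : ℝ) -
        ((((-27604149508562089749486873179266648768981480127519 / 48757245717025175203867226808691359481856000000000 : ℚ)) : ℝ) +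
          (((-1380278001696836590892131992065093010242888371 / 936139117766883363914250754726874102051635200 : ℚ)) : ℝ) * (5 / 14 : ℝ)) := by
    push_cast; norm_num
  push_cast at hdrop hnum
  nlinarith

/-! ## §3. A0 on the κ 4/7 DIAG-HOP cap line (cq A0 column-of-record edition p526218) — hubbard-floor eng-1 g5 append «T4b» -/

/-- **A0 LINEAR-RESPONSE CONSTANT FLOOR, κ 4/7 DIAG-HOP EDITION (t′ = −1/4, U = 8, n = ⅞; #504 × the κ 4/7 twins' diag-hop b1 cap at g = 3/8).** For every real `C`:
if `Re ω(P₀^d) ≤ C·s` for every translation-invariant density-⅞ minimiser `ω` of `E^{−1/4}_s` at every field `0 < s ≤ √2·3/8` (h_tree ≤ 0.53033), then **`1.0882047 ≤ C`**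
(exact `c₀ = (ℓ₅₀₄ − A − 3B/8)·32/9 = 1.0882047987…`, 7 dp DOWN; `g = 3/8` is within 0.004 of the maximiser `g* ≈ 0.3783` of `c₀` on this line, `c₀(g*) = 1.0882907…`).
CONDITIONAL by name on #504 and the two κ 4/7 DIAG-HOP W5 readings (cap witness `exists_canonicalClassA0_sourced_le_A0twoW5k4o7_b1`, the (A, B) of cq p526218
`canonicalFloorA0_n7o8_A0twoW5k4o7_b1_continuum` — the cq A0 COLUMN-OF-RECORD edition at h ≥ 0.38, RULING 416); pointwise exclusion of the same nodes at the same field `0.5441023`.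
An EXCLUSION of small constants only, under an explicit hypothesis certified by nothing; never onset / order / gap / `T_c`. [cite: Griffiths1966, §II] -/
theorem linearResponseConstantA0_ge_n7o8_tpm1o4_r504_k4o7_g3o8 (C : ℝ)
    (hlin : ∀ s : ℝ, 0 < s → s ≤ Real.sqrt 2 * (3 / 8 : ℝ) → ∀ ω : InfVolFermionState 2, ω.IsTranslationInvariant → ω.density = 7 / 8 →
      (∀ ω' : InfVolFermionState 2, ω'.IsTranslationInvariant → ω'.density = 7 / 8 →
        ω.meanEnergy (hubbardTTPrimeSourcedInteraction 1 (-1 / 4) 8 0 dWaveFormFactor s) 1 ≤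
          ω'.meanEnergy (hubbardTTPrimeSourcedInteraction 1 (-1 / 4) 8 0 dWaveFormFactor s) 1) →
      (ω.expect (pairRegion (insert 0 unitSteps) 0) (localPairAt (insert 0 unitSteps) dWaveFormFactor 0)).re ≤ C * s)
    (h504 : cert_r504_bs_GU8n7o8tpm1o4_w3_b4_R2_ob5p2_kry1_kry2c3rel_hanK7B4D4_KN4_PR20d4_hanK8c2s_uprime)
    (hW₁ : cert_sgf_openbox32x4_U8_mu2_k4o7_j270192_twoFieldDiagHop) (hW₂ : cert_sgf_openbox32x4_U8_mu9o4_k4o7_j271580_twoFieldDiagHop) :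
    (1.0882047 : ℝ) ≤ C := by
  have hh : 0 < Real.sqrt 2 * (3 / 8 : ℝ) := by positivity
  have hcap := exists_canonicalClassA0_sourced_le_A0twoW5k4o7_b1 (3 / 8 : ℝ) (by norm_num) ⟨by norm_num, by norm_num⟩ hW₁ hW₂
  have hdrop := drop_le_linearConstant_mul_sq (t' := (-1 / 4 : ℝ)) (U := (8 : ℝ)) (n := (7 / 8 : ℝ)) (by norm_num) (by norm_num) (by norm_num) hh h504 hcap hlin
  have hsq : (Real.sqrt 2 * (3 / 8 : ℝ)) ^ 2 = 9 / 32 := by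
    rw [mul_pow, Real.sq_sqrt (by norm_num : (0 : ℝ) ≤ 2)]; norm_num
  rw [hsq] at hdrop
  have hnum : (1.0882047 : ℝ) * (9 / 32) ≤
      (((-1008420703687177600106633 / 1208925819614629174706176 : ℚ)) : ℝ) -
        ((((-25501590491585580922080245215889 / 48797499589041623924736000000000 : ℚ)) : ℝ) +
          (((-82295458191130690629453953 / 49968639579178622898929664 : ℚ)) : ℝ) * (3 / 8 : ℝ)) := by
    push_cast; norm_num
  push_cast at hdrop hnum
  nlinarith

end Instances

end Summit.Ventures.CertifiedManyBodySolver.Observables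

end
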